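import Literature.NumberTheory.Irrationality.Zudilin2014.SecondTaleArithmetic
import Literature.NumberTheory.Irrationality.Zudilin2014.FirstTaleLemma7

/-!
# Zudilin 2014, second tale: the `p`-adic estimates (T3a), block by block (general parameters)

Topic `Literature/NumberTheory/Irrationality/Zudilin2014` [Zudilin2014ZetaTwo, Section 6, eq. (T3a)].
PROVED here (block lemmas for arbitrary integer blocks `[lo,hi)`, each under the explicit size hypotheses `< p²` that
give every factorial a single Legendre digit and every cover-up reciprocal `1/(i−k)` norm `≤ p`):

* the digit `digitT p a b k` = the right-hand side of **eq. (T3a)** [cite: Zudilin2014ZetaTwo, Section 6, eq. (T3a)]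
  `⌊(2k−b̂₀)/p⌋ − ⌊(2k−â₀)/p⌋ − ⌊(â₀−b̂₀)/p⌋ + ⌊(k−b̂₁)/p⌋ − ⌊(k−â₁)/p⌋ − ⌊(â₁−b̂₁)/p⌋`
  `+ Σ_{j=2,3} (⌊(b̂_j−â_j−1)/p⌋ − ⌊(k−â_j)/p⌋ − ⌊(b̂_j−1−k)/p⌋)` with INTEGER floors (`digitT_eq`), each of the
  four brackets being `0` or `1` (`fdig_nonneg_le_one`);
* the block-by-block `p`-adic norms behind (T3a) ("these estimates … follow from [Zu04]", [Zudilin2004OddZeta,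
  Lemmas 1–4]), read off the tree's cover-up form of `A_k`, `B_k` (`coefAT`, `coefBT`): a pole block at a pole of the
  block is `± binom` (one carry; `padicNorm_facZ_div_coverProd_of_mem`), off the block it is a beta value
  `± j! r!/(j+r+1)!` of norm exactly `p^{1−digit}` (`padicNorm_facZ_div_coverProd_of_not_mem`); a numerator block is
  `± binom` or `0` (`padicNorm_eval_block_div_facZ`, `…block2…`) and its derivative loses at most one `p`
  (`padicNorm_eval_derivative_block_div_facZ`, `…block2…`); cover-up sums `Σ 1/(i−k)` have norm `≤ p`
  (`padicNorm_sum_div_sub_le`).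
The assembly into (T3a) for `A_k`, `B_k` and Lemma 8's `p̂`-half is `SecondTalePadic`.

Cell pub-zeta5 (HONEST FRAMING: systematic search; no irrationality claim unless certified).
-/

noncomputable section

open Polynomial Finset

namespace Literature.NumberTheory.Irrationality.Zudilin2014

/-! ### Integer floor digits -/

/-- The one-carry digit `⌊M/p⌋ − ⌊x/p⌋ − ⌊(M−x)/p⌋` with INTEGER floors (for `p > 0`, `Int` division is the floor),
for arbitrary integers `M, x`. [cite: Zudilin2014ZetaTwo, Section 6, eq. (T3a)] -/
def fdig (p : ℕ) (M x : ℤ) : ℤ := M / (p : ℤ) - x / (p : ℤ) - (M - x) / (p : ℤ)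

/-- **The right-hand side of (T3a)** (integer floors; the numerator blocks contribute
`fdig(2k−b̂₀, â₀−b̂₀) + fdig(k−b̂₁, â₁−b̂₁)`, the pole blocks `fdig(b̂_j−â_j−1, k−â_j)`).
[cite: Zudilin2014ZetaTwo, Section 6, eq. (T3a)] -/
def digitT (p : ℕ) (a b : Fin 4 → ℤ) (k : ℤ) : ℤ :=
  fdig p (2 * k - b 0) (a 0 - b 0) + fdig p (k - b 1) (a 1 - b 1)
    + (fdig p (b 2 - a 2 - 1) (k - a 2) + fdig p (b 3 - a 3 - 1) (k - a 3))

/-- `digitT` is literally the printed right-hand side of (T3a). [cite: Zudilin2014ZetaTwo, Section 6, eq. (T3a)] -/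
theorem digitT_eq (p : ℕ) (a b : Fin 4 → ℤ) (k : ℤ) :
    digitT p a b k
      = ((2 * k - b 0) / (p : ℤ) - (2 * k - a 0) / (p : ℤ) - (a 0 - b 0) / (p : ℤ))
        + ((k - b 1) / (p : ℤ) - (k - a 1) / (p : ℤ) - (a 1 - b 1) / (p : ℤ))
        + (((b 2 - a 2 - 1) / (p : ℤ) - (k - a 2) / (p : ℤ) - (b 2 - 1 - k) / (p : ℤ))
          + ((b 3 - a 3 - 1) / (p : ℤ) - (k - a 3) / (p : ℤ) - (b 3 - 1 - k) / (p : ℤ))) := by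
  unfold digitT fdig
  rw [show 2 * k - b 0 - (a 0 - b 0) = 2 * k - a 0 by ring, show k - b 1 - (a 1 - b 1) = k - a 1 by ring,
    show b 2 - a 2 - 1 - (k - a 2) = b 2 - 1 - k by ring, show b 3 - a 3 - 1 - (k - a 3) = b 3 - 1 - k by ring]
  ring

/-- Floor superadditivity `⌊x/p⌋ + ⌊y/p⌋ ≤ ⌊(x+y)/p⌋ ≤ ⌊x/p⌋ + ⌊y/p⌋ + 1`.
[cite: Zudilin2014ZetaTwo, Section 6, eq. (T3a) (the digits are 0 or 1)] -/
private theorem ediv_add_ediv_bounds {q : ℤ} (hq : 0 < q) (x y : ℤ) :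
    x / q + y / q ≤ (x + y) / q ∧ (x + y) / q ≤ x / q + y / q + 1 := by
  have hx := Int.mul_ediv_add_emod x q
  have hy := Int.mul_ediv_add_emod y q
  have hx0 := Int.emod_nonneg x hq.ne'
  have hy0 := Int.emod_nonneg y hq.ne'
  have hx1 := Int.emod_lt_of_pos x hq
  have hy1 := Int.emod_lt_of_pos y hq
  have e : x + y = (x % q + y % q) + q * (x / q + y / q) := by linear_combination -hx - hy
  rw [e, Int.add_mul_ediv_left _ _ hq.ne']
  have h0 : 0 ≤ (x % q + y % q) / q := Int.ediv_nonneg (by linarith) hq.le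
  have h1 : (x % q + y % q) / q < 2 := by rw [Int.ediv_lt_iff_lt_mul hq]; linarith
  constructor <;> linarith

/-- Every digit is `0` or `1`. [cite: Zudilin2014ZetaTwo, Section 6, eq. (T3a)] -/
theorem fdig_nonneg_le_one {p : ℕ} (hp : 0 < p) (M x : ℤ) : 0 ≤ fdig p M x ∧ fdig p M x ≤ 1 := by
  have h := ediv_add_ediv_bounds (q := (p : ℤ)) (by exact_mod_cast hp) x (M - x)
  rw [add_sub_cancel] at h
  unfold fdig
  constructor <;> linarith [h.1, h.2]

/-- `⌊(−y−1)/q⌋ = −⌊y/q⌋ − 1`. [cite: Zudilin2014ZetaTwo, Section 6, eq. (T3a) (off-block digits)] -/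
private theorem neg_sub_one_ediv {q : ℤ} (hq : 0 < q) (y : ℤ) : (-y - 1) / q = -(y / q) - 1 := by
  have hy := Int.mul_ediv_add_emod y q
  have hr0 := Int.emod_nonneg y hq.ne'
  have hr1 := Int.emod_lt_of_pos y hq
  have e : -y - 1 = (q - 1 - y % q) + q * (-(y / q) - 1) := by linear_combination hy
  rw [e, Int.add_mul_ediv_left _ _ hq.ne', Int.ediv_eq_zero_of_lt (by linarith) (by linarith)]
  ring

/-- `⌊M/p⌋` in `ℕ` and in `ℤ` agree for `M ≥ 0`. [cite: Zudilin2014ZetaTwo, Section 6, eq. (T3a)] -/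
private theorem natCast_toNat_div (p : ℕ) {M : ℤ} (hM : 0 ≤ M) : ((M.toNat / p : ℕ) : ℤ) = M / (p : ℤ) := by
  rw [Int.natCast_ediv, Int.toNat_of_nonneg hM]

/-! ### `p`-adic bricks -/

section Padic

variable {p : ℕ} [hp : Fact p.Prime]

/-- `facZ m ≠ 0`. [cite: Zudilin2014ZetaTwo, Section 3, eq. (gc)] -/
private theorem facZ_ne_zero (m : ℤ) : facZ m ≠ 0 := by
  rw [facZ_eq]; exact_mod_cast Nat.factorial_ne_zero _

/-- `(p : ℚ) ≠ 0`. [cite: Zudilin2014ZetaTwo, Section 6, eq. (T3a)] -/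
private theorem castp_ne_zero : (p : ℚ) ≠ 0 := by exact_mod_cast hp.out.ne_zero

/-- `1 ≤ (p : ℚ)`. [cite: Zudilin2014ZetaTwo, Section 6, eq. (T3a)] -/
private theorem one_le_castp : (1 : ℚ) ≤ p := by exact_mod_cast hp.out.one_lt.le

omit hp in
/-- `‖(−1)^n‖_p = 1`. [cite: Zudilin2014ZetaTwo, Section 6, eq. (T2) (signs)] -/
private theorem padicNorm_neg_one_pow (n : ℕ) : padicNorm p ((-1 : ℚ) ^ n) = 1 := by
  rcases neg_one_pow_eq_or ℚ n with h | h <;> rw [h] <;> simp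

/-- **One Legendre digit**: `‖m!‖_p = p^{−⌊m/p⌋}` for `0 ≤ m < p²` (integer floor).
[cite: Zudilin2014ZetaTwo, proof of Lemma 7 (one digit for p > √(size))] -/
theorem padicNorm_facZ {m : ℤ} (h0 : 0 ≤ m) (hm : m < (p : ℤ) ^ 2) :
    padicNorm p (facZ m) = (p : ℚ) ^ (-(m / (p : ℤ))) := by
  have hm' : m.toNat < p ^ 2 := by
    have : (m.toNat : ℤ) < (p : ℤ) ^ 2 := by rw [Int.toNat_of_nonneg h0]; exact hm
    exact_mod_cast this
  rw [padicNorm.eq_zpow_of_nonzero (facZ_ne_zero m), padicValRat_facZ (p := p) hm', natCast_toNat_div p h0]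

/-- `‖1/d‖_p ≤ p` for a nonzero integer `d` with `|d| < p²`. [cite: Zudilin2004OddZeta, proof of Lemma 4] -/
theorem padicNorm_inv_intCast_le_of_abs_lt_sq {d : ℤ} (hd : d ≠ 0) (hlt : |d| < (p : ℤ) ^ 2) :
    padicNorm p ((d : ℚ)⁻¹) ≤ p := by
  have hp1 : 1 < p := hp.out.one_lt
  have hlt' : d.natAbs < p ^ 2 := by
    have : (d.natAbs : ℤ) < (p : ℤ) ^ 2 := by rw [Int.natCast_natAbs]; exact hlt
    exact_mod_cast this
  have hv : padicValInt p d ≤ 1 := by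
    by_contra h
    push Not at h
    have hdvd : (p : ℤ) ^ 2 ∣ d := (padicValInt_dvd_iff 2 d).2 (Or.inr (by omega))
    have : p ^ 2 ≤ d.natAbs := Nat.le_of_dvd (Int.natAbs_pos.2 hd) (by
      have := Int.natAbs_dvd_natAbs.2 hdvd; simpa using this)
    omega
  have hd' : (d : ℚ) ≠ 0 := by exact_mod_cast hd
  rw [padicNorm.eq_zpow_of_nonzero (inv_ne_zero hd'), padicValRat.inv, padicValRat.of_int, neg_neg]
  calc (p : ℚ) ^ (padicValInt p d : ℤ) ≤ (p : ℚ) ^ (1 : ℤ) :=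
        zpow_le_zpow_right₀ (by exact_mod_cast hp1.le) (by exact_mod_cast hv)
    _ = p := zpow_one _

/-- **Cover-up sums**: `‖Σ_{i∈s} c/(i−u)‖_p ≤ p` if `‖c‖_p ≤ 1` and `0 < |i−u| < p²` on `s` ("definition of the least
common multiple", one prime at a time). [cite: Zudilin2004OddZeta, proof of Lemma 4] -/
theorem padicNorm_sum_div_sub_le (s : Finset ℤ) (u : ℤ) {c : ℚ} (hc : padicNorm p c ≤ 1)
    (hs : ∀ i ∈ s, i ≠ u ∧ |i - u| < (p : ℤ) ^ 2) :
    padicNorm p (∑ i ∈ s, c / ((i : ℚ) - u)) ≤ p := by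
  refine padicNorm.sum_le' (fun i hi => ?_) (by positivity)
  obtain ⟨hne, hlt⟩ := hs i hi
  rw [div_eq_mul_inv, padicNorm.mul, show ((i : ℚ) - u) = ((i - u : ℤ) : ℚ) by push_cast; ring]
  calc padicNorm p c * padicNorm p (((i - u : ℤ) : ℚ)⁻¹) ≤ 1 * (p : ℚ) :=
        mul_le_mul hc (padicNorm_inv_intCast_le_of_abs_lt_sq (sub_ne_zero.2 hne) hlt) (padicNorm.nonneg _) zero_le_one
    _ = p := one_mul _

/-- Norm bookkeeping: products add exponents. [cite: Zudilin2014ZetaTwo, Section 6, eq. (T3a)] -/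
private theorem norm_mul_le {x y : ℚ} {e f : ℤ} (hx : padicNorm p x ≤ (p : ℚ) ^ e) (hy : padicNorm p y ≤ (p : ℚ) ^ f) :
    padicNorm p (x * y) ≤ (p : ℚ) ^ (e + f) := by
  rw [padicNorm.mul, zpow_add₀ castp_ne_zero]
  exact mul_le_mul hx hy (padicNorm.nonneg _) (zpow_nonneg (by positivity) _)

/-- Norm bookkeeping: the ultrametric inequality. [cite: Zudilin2014ZetaTwo, Section 6, eq. (T3a)] -/
private theorem norm_add_le {x y : ℚ} {e : ℤ} (hx : padicNorm p x ≤ (p : ℚ) ^ e) (hy : padicNorm p y ≤ (p : ℚ) ^ e) :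
    padicNorm p (x + y) ≤ (p : ℚ) ^ e :=
  (padicNorm.nonarchimedean (p := p)).trans (max_le hx hy)

/-- Norm bookkeeping: the ultrametric inequality for a difference. [cite: Zudilin2014ZetaTwo, Section 6, eq. (T3a)] -/
private theorem norm_sub_le {x y : ℚ} {e : ℤ} (hx : padicNorm p x ≤ (p : ℚ) ^ e) (hy : padicNorm p y ≤ (p : ℚ) ^ e) :
    padicNorm p (x - y) ≤ (p : ℚ) ^ e := by
  rw [sub_eq_add_neg]; exact norm_add_le hx (by rwa [padicNorm.neg])

/-! ### The pole blocks -/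

/-- **Pole block at a pole of the block** (`k ∈ [lo,hi)`, `hi − lo ≤ p²`): `(hi−lo−1)!/∏_{i≠k}(i−k) = ± binom(hi−lo−1, k−lo)`
has norm exactly `p^{−(⌊(hi−lo−1)/p⌋ − ⌊(k−lo)/p⌋ − ⌊(hi−1−k)/p⌋)}`.
[cite: Zudilin2014ZetaTwo, Section 6, eq. (T3a)] [cite: Zudilin2004OddZeta, Lemma 3] -/
theorem padicNorm_facZ_div_coverProd_of_mem {lo hi k : ℤ} (hk : k ∈ Ico lo hi) (hsz : hi - lo ≤ (p : ℤ) ^ 2) :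
    padicNorm p (facZ (hi - lo - 1) / coverProd lo hi k) = (p : ℚ) ^ (-fdig p (hi - lo - 1) (k - lo)) := by
  have hk' := mem_Ico.1 hk
  rw [coverProd_of_mem hk, padicNorm.div, padicNorm.mul, padicNorm.mul, padicNorm_neg_one_pow, one_mul,
    padicNorm_facZ (by omega) (by omega), padicNorm_facZ (by omega) (by omega), padicNorm_facZ (by omega) (by omega),
    ← zpow_add₀ castp_ne_zero, ← zpow_sub₀ castp_ne_zero]
  congr 1
  unfold fdig
  rw [show hi - lo - 1 - (k - lo) = hi - 1 - k by ring]
  ring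

/-- **Pole block off the block** (`k ∉ [lo,hi)`, `lo < hi`): `(hi−lo−1)!/∏_{lo≤i<hi}(i−k)` is the beta value
`± j! r!/(j+r+1)!` (`r = hi−lo−1`; `j = lo−1−k` if `k < lo`, `j = k−hi` if `k ≥ hi`), of norm exactly `p^{1−digit}`
when `j + r + 1 < p²`. [cite: Zudilin2014ZetaTwo, Section 6, eq. (T3a)] [cite: Zudilin2004OddZeta, Lemmas 2–3] -/
theorem padicNorm_facZ_div_coverProd_of_not_mem {lo hi k : ℤ} (hlh : lo < hi) (hk : k ∉ Ico lo hi)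
    (h1 : hi - 1 - k < (p : ℤ) ^ 2) (h2 : k - lo < (p : ℤ) ^ 2) :
    padicNorm p (facZ (hi - lo - 1) / coverProd lo hi k) = (p : ℚ) ^ (1 - fdig p (hi - lo - 1) (k - lo)) := by
  have hq : (0 : ℤ) < p := by exact_mod_cast hp.out.pos
  have hcp : coverProd lo hi k = ∏ i ∈ Ico lo hi, ((i : ℚ) - k) := by
    unfold coverProd; rw [erase_eq_of_notMem hk]
  rcases lt_or_ge k lo with hklo | hklo
  · -- `k < lo`: `(lo−1−k)! · ∏_{lo≤i<hi}(i−k) = (hi−1−k)!`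
    have hprod : facZ (lo - 1 - k) * coverProd lo hi k = facZ (hi - 1 - k) := by
      rw [hcp, facZ_eq, facZ_eq]
      have hu : Ico (k + 1) lo ∪ Ico lo hi = Ico (k + 1) hi := Ico_union_Ico_eq_Ico (by omega) hlh.le
      have hd : Disjoint (Ico (k + 1) lo) (Ico lo hi) := Ico_disjoint_Ico_consecutive _ _ _
      have e2 := prod_Ico_succ_sub_eq k hi (by omega)
      rw [← hu, prod_union hd, prod_Ico_succ_sub_eq k lo hklo] at e2
      exact_mod_cast e2
    have e : facZ (hi - lo - 1) / coverProd lo hi k = facZ (hi - lo - 1) * facZ (lo - 1 - k) / facZ (hi - 1 - k) := by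
      rw [← hprod]
      have := facZ_ne_zero (lo - 1 - k)
      have := coverProd_ne_zero lo hi k
      field_simp
    rw [e, padicNorm.div, padicNorm.mul, padicNorm_facZ (by omega) (by omega), padicNorm_facZ (by omega) (by omega),
      padicNorm_facZ (by omega) (by omega), ← zpow_add₀ castp_ne_zero, ← zpow_sub₀ castp_ne_zero]
    congr 1
    unfold fdig
    rw [show k - lo = -(lo - 1 - k) - 1 by ring, show hi - lo - 1 - (-(lo - 1 - k) - 1) = hi - 1 - k by ring,
      neg_sub_one_ediv hq]
    ring
  · -- `hi ≤ k`: `∏_{lo≤i<hi}(i−k) · (k−hi)! = (−1)^{hi−lo} (k−lo)!`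
    have hkhi : hi ≤ k := by
      by_contra h
      exact hk (mem_Ico.2 ⟨hklo, by omega⟩)
    have hprod : coverProd lo hi k * facZ (k - hi) = (-1) ^ (hi - lo).toNat * facZ (k - lo) := by
      rw [hcp, prod_Ico_sub_eq lo hi k hlh.le hkhi, facZ_eq, facZ_eq]
      have hle : (hi - lo).toNat ≤ (k - lo).toNat := by omega
      have hcf := Nat.choose_mul_factorial_mul_factorial hle
      rw [show (k - lo).toNat - (hi - lo).toNat = (k - hi).toNat by omega] at hcf
      have hq' : ((Nat.choose (k - lo).toNat (hi - lo).toNat : ℕ) : ℚ) * ((hi - lo).toNat.factorial : ℚ)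
          * ((k - hi).toNat.factorial : ℚ) = ((k - lo).toNat.factorial : ℚ) := by exact_mod_cast hcf
      linear_combination ((-1 : ℚ) ^ (hi - lo).toNat) * hq'
    have hcv : coverProd lo hi k = (-1) ^ (hi - lo).toNat * (facZ (k - lo) / facZ (k - hi)) := by
      rw [← mul_div_assoc, eq_div_iff (facZ_ne_zero _)]; exact hprod
    have e : facZ (hi - lo - 1) / coverProd lo hi k
        = (-1) ^ (hi - lo).toNat * (facZ (hi - lo - 1) * facZ (k - hi) / facZ (k - lo)) := by
      rw [hcv, div_neg_one_pow_mul, div_div_eq_mul_div]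
    rw [e, padicNorm.mul, padicNorm_neg_one_pow, one_mul, padicNorm.div, padicNorm.mul,
      padicNorm_facZ (by omega) (by omega), padicNorm_facZ (by omega) (by omega), padicNorm_facZ (by omega) (by omega),
      ← zpow_add₀ castp_ne_zero, ← zpow_sub₀ castp_ne_zero]
    congr 1
    unfold fdig
    rw [show hi - lo - 1 - (k - lo) = -(k - hi) - 1 by ring, neg_sub_one_ediv hq]
    ring

/-! ### The numerator blocks -/

/-- Derivative of `∏_{i∈s}(X + i)` at a root `x = −i₀`: `∏_{i≠i₀}(x + i)`.
[cite: Zudilin2014ZetaTwo, Section 6, eq. (T3a)] [cite: Zudilin2004OddZeta, Lemma 1] -/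
theorem eval_derivative_prodX_root (s : Finset ℤ) {x : ℚ} {i₀ : ℤ} (hi₀ : i₀ ∈ s) (hx : x + i₀ = 0) :
    (derivative (∏ i ∈ s, (X + C (i : ℚ)))).eval x = ∏ i ∈ s.erase i₀, (x + i) := by
  rw [derivative_prod_finset, eval_finsetSum, ← add_sum_erase s _ hi₀]
  have hrest : ∑ i ∈ s.erase i₀, ((∏ j ∈ (s.erase i), (X + C (j : ℚ))) * derivative (X + C (i : ℚ))).eval x = 0 := by
    refine sum_eq_zero fun i hi => ?_
    have hi' : i₀ ∈ s.erase i := mem_erase.2 ⟨(ne_of_mem_erase hi).symm, hi₀⟩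
    rw [eval_mul, eval_prod, prod_eq_zero hi' (by simp [hx]), zero_mul]
  rw [hrest, add_zero, eval_mul, derivative_add, derivative_X, derivative_C, add_zero, eval_one, mul_one, eval_prod]
  exact prod_congr rfl fun i _ => by simp

/-- **Numerator block at `−k`** (`lo ≤ hi`, `lo ≤ k`, `k − lo < p²`): `block(−k)/(hi−lo)!` is `± binom(k−lo, hi−lo)`
(`k ≥ hi`) or `0` (`k < hi`), so its norm is `≤ p^{−(⌊(k−lo)/p⌋ − ⌊(hi−lo)/p⌋ − ⌊(k−hi)/p⌋)}`.
[cite: Zudilin2014ZetaTwo, Section 6, eq. (T3a)] [cite: Zudilin2004OddZeta, Lemma 1] -/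
theorem padicNorm_eval_block_div_facZ {lo hi k : ℤ} (hlh : lo ≤ hi) (hk : lo ≤ k) (hsz : k - lo < (p : ℤ) ^ 2) :
    padicNorm p ((block lo hi).eval (-(k : ℚ)) / facZ (hi - lo)) ≤ (p : ℚ) ^ (-fdig p (k - lo) (hi - lo)) := by
  rw [eval_block]
  have e : ∏ i ∈ Ico lo hi, (-(k : ℚ) + i) = ∏ i ∈ Ico lo hi, ((i : ℚ) - k) :=
    prod_congr rfl fun i _ => by ring
  rw [e]
  rcases lt_or_ge k hi with hkhi | hkhi
  · rw [prod_eq_zero (mem_Ico.2 ⟨hk, hkhi⟩) (by simp), zero_div, padicNorm.zero]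
    positivity
  · have hf := facZ_ne_zero
    have hC : ((Nat.choose (k - lo).toNat (hi - lo).toNat : ℕ) : ℚ)
        = facZ (k - lo) / (facZ (hi - lo) * facZ (k - hi)) := by
      rw [eq_div_iff (mul_ne_zero (hf _) (hf _)), facZ_eq, facZ_eq, facZ_eq]
      have hcf := Nat.choose_mul_factorial_mul_factorial (show (hi - lo).toNat ≤ (k - lo).toNat by omega)
      rw [show (k - lo).toNat - (hi - lo).toNat = (k - hi).toNat by omega] at hcf
      rw [← mul_assoc]; exact_mod_cast hcf
    rw [prod_Ico_sub_eq lo hi k hlh hkhi]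
    have e2 : (-1) ^ (hi - lo).toNat * (((hi - lo).toNat.factorial : ℕ) : ℚ)
        * ((Nat.choose (k - lo).toNat (hi - lo).toNat : ℕ) : ℚ) / facZ (hi - lo)
        = (-1) ^ (hi - lo).toNat * (facZ (k - lo) / (facZ (hi - lo) * facZ (k - hi))) := by
      rw [hC, facZ_eq (hi - lo)]
      have := hf (hi - lo); rw [facZ_eq] at this
      field_simp
    rw [e2, padicNorm.mul, padicNorm_neg_one_pow, one_mul, padicNorm.div, padicNorm.mul,
      padicNorm_facZ (by omega) (by omega), padicNorm_facZ (by omega) (by omega), padicNorm_facZ (by omega) (by omega),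
      ← zpow_add₀ castp_ne_zero, ← zpow_sub₀ castp_ne_zero]
    apply le_of_eq
    congr 1
    unfold fdig
    rw [show k - lo - (hi - lo) = k - hi by ring]
    ring

/-- **Derivative of a numerator block at `−k`** (`lo ≤ hi`, `lo ≤ k`, `k − lo, hi − lo < p²`): off the roots it is
`block(−k) · Σ 1/(i−k)` (one `p` lost in the sum), at a root it is `± (k−lo)!(hi−1−k)!`; either way
`‖block′(−k)/(hi−lo)!‖_p ≤ p^{1 − digit}`. [cite: Zudilin2014ZetaTwo, Section 6, eq. (T3a)] [cite: Zudilin2004OddZeta, Lemma 1] -/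
theorem padicNorm_eval_derivative_block_div_facZ {lo hi k : ℤ} (hlh : lo ≤ hi) (hk : lo ≤ k)
    (hsz : k - lo < (p : ℤ) ^ 2) (hsz' : hi - lo < (p : ℤ) ^ 2) :
    padicNorm p ((derivative (block lo hi)).eval (-(k : ℚ)) / facZ (hi - lo))
      ≤ (p : ℚ) ^ (1 - fdig p (k - lo) (hi - lo)) := by
  have hq : (0 : ℤ) < p := by exact_mod_cast hp.out.pos
  rcases lt_or_ge k hi with hkhi | hkhi
  · -- at a root
    have hkm : k ∈ Ico lo hi := mem_Ico.2 ⟨hk, hkhi⟩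
    unfold block
    rw [eval_derivative_prodX_root (Ico lo hi) hkm (by ring)]
    have e : ∏ i ∈ (Ico lo hi).erase k, (-(k : ℚ) + i) = coverProd lo hi k := by
      unfold coverProd; exact prod_congr rfl fun i _ => by ring
    rw [e, coverProd_of_mem hkm, padicNorm.div, padicNorm.mul, padicNorm.mul, padicNorm_neg_one_pow, one_mul,
      padicNorm_facZ (by omega) (by omega), padicNorm_facZ (by omega) (by omega), padicNorm_facZ (by omega) (by omega),
      ← zpow_add₀ castp_ne_zero, ← zpow_sub₀ castp_ne_zero]
    apply le_of_eq
    congr 1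
    unfold fdig
    rw [show k - lo - (hi - lo) = -(hi - 1 - k) - 1 by ring, neg_sub_one_ediv hq]
    ring
  · -- off the roots
    have hx : ∀ i ∈ Ico lo hi, -(k : ℚ) + i ≠ 0 := fun i hi h => by
      have hi' := mem_Ico.1 hi
      have : ((i : ℤ) : ℚ) = k := by linarith
      have : i = k := by exact_mod_cast this
      omega
    unfold block
    rw [eval_derivative_prodX_eq _ hx, ← eval_block, mul_div_right_comm, show (1 : ℤ) - fdig p (k - lo) (hi - lo)
      = -fdig p (k - lo) (hi - lo) + 1 by ring]
    refine norm_mul_le (padicNorm_eval_block_div_facZ hlh hk hsz) ?_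
    have e : ∑ i ∈ Ico lo hi, 1 / (-(k : ℚ) + i) = ∑ i ∈ Ico lo hi, 1 / ((i : ℚ) - k) :=
      sum_congr rfl fun i _ => by rw [neg_add_eq_sub]
    rw [e, zpow_one]
    exact padicNorm_sum_div_sub_le _ _ (by simp) fun i hi => by
      have hi' := mem_Ico.1 hi
      exact ⟨by omega, by rw [abs_lt]; constructor <;> omega⟩

/-- The doubled block: `‖block2(−k)/(hi−lo)!‖_p ≤ p^{−digit(2k−lo, hi−lo)}`. [cite: Zudilin2014ZetaTwo, Section 6, eq. (T3a)] -/
theorem padicNorm_eval_block2_div_facZ {lo hi k : ℤ} (hlh : lo ≤ hi) (hk : lo ≤ 2 * k) (hsz : 2 * k - lo < (p : ℤ) ^ 2) :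
    padicNorm p ((block2 lo hi).eval (-(k : ℚ)) / facZ (hi - lo)) ≤ (p : ℚ) ^ (-fdig p (2 * k - lo) (hi - lo)) := by
  have h := padicNorm_eval_block_div_facZ (p := p) hlh hk hsz
  rw [eval_block2_eq, show (2 : ℚ) * -(k : ℚ) = -(((2 * k : ℤ)) : ℚ) by push_cast; ring]
  exact h

/-- The doubled block's derivative: `‖block2′(−k)/(hi−lo)!‖_p ≤ p^{1−digit(2k−lo, hi−lo)}` (the factor `2` has
norm `≤ 1`). [cite: Zudilin2014ZetaTwo, Section 6, eq. (T3a)] -/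
theorem padicNorm_eval_derivative_block2_div_facZ {lo hi k : ℤ} (hlh : lo ≤ hi) (hk : lo ≤ 2 * k)
    (hsz : 2 * k - lo < (p : ℤ) ^ 2) (hsz' : hi - lo < (p : ℤ) ^ 2) :
    padicNorm p ((derivative (block2 lo hi)).eval (-(k : ℚ)) / facZ (hi - lo))
      ≤ (p : ℚ) ^ (1 - fdig p (2 * k - lo) (hi - lo)) := by
  have h := padicNorm_eval_derivative_block_div_facZ (p := p) hlh hk hsz hsz'
  rw [eval_derivative_block2_eq, show (2 : ℚ) * -(k : ℚ) = -(((2 * k : ℤ)) : ℚ) by push_cast; ring, mul_div_assoc,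
    padicNorm.mul]
  have h2 : padicNorm p (2 : ℚ) ≤ 1 := by have := padicNorm.of_int (p := p) 2; exact_mod_cast this
  calc padicNorm p 2 * _ ≤ 1 * (p : ℚ) ^ (1 - fdig p (2 * k - lo) (hi - lo)) :=
        mul_le_mul h2 h (padicNorm.nonneg _) zero_le_one
    _ = _ := one_mul _

end Padic

end Literature.NumberTheory.Irrationality.Zudilin2014

end
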